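/-
Copyright (c) 2026 the pub-hodgecm-mathlib formalisation cell (harness21).  Prover seat hodgecm-mathlib-F0P2-p07 (g2): Track B «K2-LIT»,
hLiu418 = stmt-HodgeConjecture-24832; LEAD F0P6-plan (g15) RULING M-160f ∕ BATCH #235 «(σ-A) brick [A1-mat]», ED. 2 heads invited by the [A1-mat] pen F0P2-p10 (g3)
2026-09-05T01:37:05Z, (σ-A) road desk K2Liu-p25 (g3) WORD #1 (c), [A1] pen K2Liu-p09 (g9) 01:31:42Z (b)(c) — filed as a SIBLING of ★ `K2LiuLocalFourCornerFactorisation`.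
-/
import Summits.HodgeConjecture.HodgeConjecture.Theorems.K2LiuLocalFourCornerFactorisation   -- ★ [A1-mat] (F0P2-p10 (g3)): §3 `adapt_matA_flip_mul_frameConj_weylTwo`
import HarnessLib

/-!
# Crux `HLiu418`, road `K2_Liu`, (σ-A) brick [A1-mat], sequel: THE LEVI FACTOR'S KEYS OF `φ(w₂) = w₁ · m` AND THE Δ-ADAPTED FRAME OF RECORD IS
# ANTIDIAGONAL AT A DIAGONAL `T₂` (the discharge of ★ [A1-mat] §3's hypotheses `hDa`, `hDia` at the K1a datum)

Cell `hodgecm-mathlib`, crux item hLiu418 = `stmt-HodgeConjecture-24832`; squad K2 ∕ K2Liu; prover F0P2-p07 (g2).  THEOREMS ONLY (no `def`, no instance,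
no notation, no named-fact hypothesis, no `sorry`, default heartbeats); lane `--supports stmt-HodgeConjecture-24832 --as helper` (count-neutral helper).

SETTING = ★ `K2LiuLocalFourCornerFactorisation` (binders of ★ p863595 `chainValues_of_placeLetter` VERBATIM: `E/F`, `c`, `δ`, `v`, `T₂`, `J₂D`, the frame
`(D, Dinv, hDD, Q, hQm, hQ)`, `φ X = frameConj Q (toLocalFour X)`, `ι = toLocalRing ∘ algebraMap F F_v`).
* §1 THE LEVI FACTOR'S KEYS.  ★ [A1-mat] §3 gives, at an antidiagonal frame `D = (0 d₁; d₂ 0)`, `Dinv = (0 e₁; e₂ 0)` and for any flip `w₁` of the second line,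
  `adapt (matA (w₁ · φ(w₂))) = diag((1 0; 0 ι d₂), (1 0; 0 ι e₁))` with `IsSiegelDelta` and `blkB = 0`; the [A1] pen's Levi word (★ `K2LiuBlockImplementerLeviAction`)
  is keyed on `(IsSiegelDelta p, blkA p)` — **`blkA_blkD_flip_mul_frameConj_weylTwo`** (`blkA = diag(1, ι d₂) = 1 − P + ι d₂ • P`, `blkD = diag(1, ι e₁)`) and
  **`detDelta_flip_mul_frameConj_weylTwo`** (`det_Δ(w₁ φ(w₂))_w = (ι d₂)_w`, ★ `detDelta_levi`).
* §2 THE FRAME OF RECORD.  The K1a chain takes its seven frame binders `(D, Dinv, hDD, hDD', Q, hQm, hQ)` from ★ `K2LiuA7NormalisedRegularityCM.exists_adaptedFrame`,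
  whose `∃` hides `D = ½ T₂⁻¹ W`, `Dinv = 2 W T₂` (`W = antidiag(1,1)`); for a DIAGONAL `T₂ = diag(t₁, t₂)` (the CM datum: `T₂ = gramR` is diagonal) these ARE
  antidiagonal: **`frameD_of_diagonal`** (`½ T₂⁻¹ W = (0, ½t₁⁻¹; ½t₂⁻¹, 0)`), **`frameDinv_of_diagonal`** (`2 W T₂ = (0, 2t₂; 2t₁, 0)`), and
  **`exists_antidiagFrame`** re-exports the seven binders WITH the two equalities (same construction as ★ `exists_adaptedFrame` over ★ B7
  `K2LiuLocalSiegelIwasawaFrame`), so ★ [A1-mat] §3 applies with `d₁ = ½t₁⁻¹`, `d₂ = ½t₂⁻¹`, `e₁ = 2t₂`, `e₂ = 2t₁` (`frameOfRecord_d_mul_e`: `d₂ e₁ = d₁ e₂ = 1`).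
HONEST LABEL.  Count-neutral helper: `HC_CM` is proved only modulo the 7 printed citations (2 remaining named inputs: hLiu418 = `stmt-HodgeConjecture-24832`,
h413 = `stmt-HodgeConjecture-24833`) until rung 0 closes.

## References
* [HarrisKudlaSweet1996] M. Harris, S. Kudla, W. J. Sweet, *Theta dichotomy for unitary groups*, J. AMS 9 (1996): §1 (1.11)–(1.12), (1.15) (`P_Δ = M_Δ N_Δ`, the frame, `det_Δ`).
* [Kudla1994] S. S. Kudla, *Splitting metaplectic covers of dual reductive pairs*, Israel J. Math. 87 (1994): §3 (the `Δ`-adapted frame, `x(p) = det_Δ`).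
* [Casselman1980] W. Casselman, Compositio Math. 40 (1980): §3 (rank-one reduction).
-/

set_option autoImplicit false
set_option linter.dupNamespace false -- the mandated namespace repeats `HodgeConjecture.HodgeConjecture`

noncomputable section

open NumberField IsDedekindDomain Matrix
open Literature.NumberTheory.Automorphic Literature.NumberTheory.Automorphic.UnitaryGroup
open Literature.NumberTheory.GelbartRogawski1991.AdaptedBlocks
open Literature.NumberTheory.GelbartRogawski1991.UnitaryDualPair.LocalSplitting
open Literature.NumberTheory.K2Lit.LocalSiegelDoubled
open Summit.HodgeConjecture.HodgeConjecture.Cruxes.HLiu418.K2LiuLocalSiegelIwasawaFrame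
open Summit.HodgeConjecture.HodgeConjecture.Cruxes.HLiu418.K2LiuLocalSiegelIwasawa
open Summit.HodgeConjecture.HodgeConjecture.Cruxes.HLiu418.K2LiuDoubledUTwoTwoBorelFrame
open Summit.HodgeConjecture.HodgeConjecture.Cruxes.HLiu418.K2LiuDoubledUTwoTwoWeylCocycle
open Summit.HodgeConjecture.HodgeConjecture.Cruxes.HLiu418.K2LiuDoubledUTwoTwoFrameTransport
open Summit.HodgeConjecture.HodgeConjecture.Cruxes.HLiu418.K2LiuSiegelLeviWeylAlgebra
open Summit.HodgeConjecture.HodgeConjecture.Cruxes.HLiu418.K2LiuLocalFourCornerFactorisation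

namespace Summit.HodgeConjecture.HodgeConjecture.Cruxes.HLiu418.K2LiuLocalFourCornerFrameOfRecord

variable (F : Type) [Field F] [NumberField F] (E : Type) [Field E] [NumberField E] [Algebra F E]
  [Algebra.IsQuadraticExtension F E] (c : E ≃ₐ[F] E)
  {δ : E} (hcδ : c δ = -δ) (hδ : δ ≠ 0) {d : F} (hd : δ * δ = algebraMap F E d) (v : HeightOneSpectrum (𝓞 F))
  {T₂ : Matrix (Fin 2) (Fin 2) F} (hT₂ : T₂.IsSymm) {J₂D : Matrix (Fin (2 + 2)) (Fin (2 + 2)) E} (hJ₂D : J₂D = (gramD F 2 T₂).map (algebraMap F E))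
  (D Dinv : Matrix (Fin 2) (Fin 2) F) (hDD : D * Dinv = 1) (Q : GL (Fin (2 + 2)) F)
  (hQm : (Q : Matrix (Fin (2 + 2)) (Fin (2 + 2)) F) = Matrix.reindex (e₂ 2) (e₂ 2) (Matrix.fromBlocks 1 D 1 (-D)))
  (hQ : (Q : Matrix (Fin (2 + 2)) (Fin (2 + 2)) F)ᵀ * gramD F 2 T₂ * (Q : Matrix (Fin (2 + 2)) (Fin (2 + 2)) F) = (StdForm.antidiagonal (2 + 2)).over F)

/-! ## §1 The Levi factor's keys: `blkA`, `blkD`, `det_Δ` of `w₁ · φ(w₂)` -/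

section LeviFactorKeys

variable {d₁ d₂ e₁ e₂ : F} (hDa : D = !![0, d₁; d₂, 0]) (hDia : Dinv = !![0, e₁; e₂, 0])

omit [Algebra.IsQuadraticExtension F E] in
include hJ₂D hDD hQm hDa hDia in
/-- **the `Δ`-block and the `Δ⁻`-block of the Levi factor**: `blkA (matA (w₁ · φ(w₂))) = diag(1, ι d₂) = 1 − P + ι d₂ • P` and `blkD = diag(1, ι e₁)`, for any flip `w₁`
of the second line — the `blkA` key of ★ `K2LiuBlockImplementerLeviAction` (with §3 `isSiegelDelta_flip_mul_frameConj_weylTwo`). [cite: HarrisKudlaSweet1996, §1 (1.12), (1.15)] [cite: Kudla1994, §3] -/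
theorem blkA_blkD_flip_mul_frameConj_weylTwo (w₁ : UnitaryGroup.localPi E c (2 + 2) J₂D v)
    (hw₁ : adapt (matA F E c v 2 w₁) = Matrix.fromBlocks !![1, 0; 0, 0] !![0, 0; 0, 1] !![0, 0; 0, 1] !![1, 0; 0, 0]) :
    blkA (matA F E c v 2 (w₁ * FrameTransport.frameConj F E c v (2 + 2) hJ₂D (antidiagonal_over_eq_map F E 2) Q hQ
        (toLocalFour F E c v (weylTwo (UnitaryGroup.LocalRing E v) (UnitaryGroup.conjLocal E c v))))) =
        !![1, 0; 0, (UnitaryGroup.toLocalRing E v).comp (algebraMap F (v.adicCompletion F)) d₂] ∧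
      blkD (matA F E c v 2 (w₁ * FrameTransport.frameConj F E c v (2 + 2) hJ₂D (antidiagonal_over_eq_map F E 2) Q hQ
        (toLocalFour F E c v (weylTwo (UnitaryGroup.LocalRing E v) (UnitaryGroup.conjLocal E c v))))) =
        !![1, 0; 0, (UnitaryGroup.toLocalRing E v).comp (algebraMap F (v.adicCompletion F)) e₁] := by
  have h := adapt_matA_flip_mul_frameConj_weylTwo F E c v hJ₂D D Dinv hDD Q hQm hQ hDa hDia w₁ hw₁
  rw [adapt_eq] at h
  obtain ⟨hA, -, -, hD⟩ := Matrix.fromBlocks_inj.1 h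
  exact ⟨hA, hD⟩

omit [Algebra.IsQuadraticExtension F E] in
include hJ₂D hDD hQm hDa hDia in
/-- **`det_Δ(w₁ · φ(w₂))_w = (ι d₂)_w`** at every `w ∣ v` (★ `detDelta_levi`: `C = 0 ⇒ det_Δ = det blkA`) — the argument of the Siegel character of the Levi factor.
[cite: HarrisKudlaSweet1996, §1 (1.15)] [cite: Kudla1994, §3] -/
theorem detDelta_flip_mul_frameConj_weylTwo (w₁ : UnitaryGroup.localPi E c (2 + 2) J₂D v)
    (hw₁ : adapt (matA F E c v 2 w₁) = Matrix.fromBlocks !![1, 0; 0, 0] !![0, 0; 0, 1] !![0, 0; 0, 1] !![1, 0; 0, 0]) (w : PlacesOver E v) :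
    detDelta F E c v 2 w (w₁ * FrameTransport.frameConj F E c v (2 + 2) hJ₂D (antidiagonal_over_eq_map F E 2) Q hQ
        (toLocalFour F E c v (weylTwo (UnitaryGroup.LocalRing E v) (UnitaryGroup.conjLocal E c v)))) =
      ((UnitaryGroup.toLocalRing E v).comp (algebraMap F (v.adicCompletion F)) d₂) w := by
  have h := adapt_matA_flip_mul_frameConj_weylTwo F E c v hJ₂D D Dinv hDD Q hQm hQ hDa hDia w₁ hw₁
  rw [adapt_eq] at h
  obtain ⟨hA, -, hC, -⟩ := Matrix.fromBlocks_inj.1 h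
  rw [detDelta_levi F E c v 2 hC w, hA, Matrix.det_fin_two_of]
  simp

end LeviFactorKeys

/-! ## §2 The frame of record `D = ½ T₂⁻¹ W`, `Dinv = 2 W T₂` is antidiagonal at a diagonal `T₂` -/

section FrameOfRecord

variable {t₁ t₂ : F}

omit [NumberField F] in
/-- the inverse of an invertible diagonal `2 × 2` matrix. [folklore] -/
theorem inv_diagTwo (h₁ : t₁ ≠ 0) (h₂ : t₂ ≠ 0) : (!![t₁, 0; 0, t₂] : Matrix (Fin 2) (Fin 2) F)⁻¹ = !![t₁⁻¹, 0; 0, t₂⁻¹] := by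
  refine Matrix.inv_eq_left_inv ?_
  ext i j; fin_cases i <;> fin_cases j <;> simp [Matrix.mul_apply, Fin.sum_univ_two, h₁, h₂]

omit [NumberField F] in
/-- the antidiagonal permutation `W = 1.submatrix id rev = (0 1; 1 0)` at `n = 2`. [folklore] -/
theorem submatrix_one_id_rev_two : (1 : Matrix (Fin 2) (Fin 2) F).submatrix id Fin.rev = !![0, 1; 1, 0] := by
  ext i j; fin_cases i <;> fin_cases j <;> rfl

omit [NumberField F] in
/-- `Wᵀ = 1.submatrix rev id = (0 1; 1 0)` at `n = 2`. [folklore] -/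
theorem submatrix_one_rev_id_two : (1 : Matrix (Fin 2) (Fin 2) F).submatrix Fin.rev id = !![0, 1; 1, 0] := by
  ext i j; fin_cases i <;> fin_cases j <;> rfl

omit [NumberField F] in
/-- **`D = ½ T₂⁻¹ W` IS ANTIDIAGONAL for diagonal `T₂ = diag(t₁, t₂)`**: `½ T₂⁻¹ W = (0, ½t₁⁻¹; ½t₂⁻¹, 0)` (`W = 1.submatrix id rev = antidiag(1,1)`, the frame of ★ B7 ∕ ★
`exists_adaptedFrame`). [cite: HarrisKudlaSweet1996, §1 (1.11)] -/
theorem frameD_of_diagonal (h₁ : t₁ ≠ 0) (h₂ : t₂ ≠ 0) :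
    (2 : F)⁻¹ • ((!![t₁, 0; 0, t₂] : Matrix (Fin 2) (Fin 2) F)⁻¹ * (1 : Matrix (Fin 2) (Fin 2) F).submatrix id Fin.rev) = !![0, 2⁻¹ * t₁⁻¹; 2⁻¹ * t₂⁻¹, 0] := by
  rw [inv_diagTwo F h₁ h₂, submatrix_one_id_rev_two F]
  ext i j; fin_cases i <;> fin_cases j <;> simp

omit [NumberField F] in
/-- **`Dinv = 2 W T₂` IS ANTIDIAGONAL for diagonal `T₂`**: `2 W T₂ = (0, 2t₂; 2t₁, 0)`. [cite: HarrisKudlaSweet1996, §1 (1.11)] -/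
theorem frameDinv_of_diagonal :
    (2 : F) • ((1 : Matrix (Fin 2) (Fin 2) F).submatrix Fin.rev id * !![t₁, 0; 0, t₂]) = !![0, 2 * t₂; 2 * t₁, 0] := by
  rw [submatrix_one_rev_id_two F]
  ext i j; fin_cases i <;> fin_cases j <;> simp

omit [NumberField F] in
/-- a diagonal `2 × 2` matrix is symmetric. [folklore] -/
theorem isSymm_diagTwo : (!![t₁, 0; 0, t₂] : Matrix (Fin 2) (Fin 2) F).IsSymm := by
  unfold Matrix.IsSymm
  ext i j; fin_cases i <;> fin_cases j <;> rfl

omit [NumberField F] in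
/-- `det diag(t₁, t₂) = t₁ t₂` is a unit for `t₁ t₂ ≠ 0`. [folklore] -/
theorem isUnit_det_diagTwo (h₁ : t₁ ≠ 0) (h₂ : t₂ ≠ 0) : IsUnit (!![t₁, 0; 0, t₂] : Matrix (Fin 2) (Fin 2) F).det := by
  rw [Matrix.det_fin_two_of, mul_zero, sub_zero]
  exact isUnit_iff_ne_zero.2 (mul_ne_zero h₁ h₂)

/-- ★ **THE Δ-ADAPTED FRAME OF RECORD IS ANTIDIAGONAL AT A DIAGONAL `T₂`.**  For `T₂ = diag(t₁, t₂)` with `t₁ t₂ ≠ 0`, the seven frame binders of ★ p863595 ∕ ★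
`exists_adaptedFrame` — `D Dinv` with `D Dinv = 1 = Dinv D`, `Q = e₂ ∘ (1 D; 1 −D)` with `Qᵀ (T₂ ⊕ −T₂) Q = J₄` — exist WITH `D = (0, ½t₁⁻¹; ½t₂⁻¹, 0)` and
`Dinv = (0, 2t₂; 2t₁, 0)`: the hypotheses `hDa`, `hDia` of §3 (`d₁ = ½t₁⁻¹`, `d₂ = ½t₂⁻¹`, `e₁ = 2t₂`, `e₂ = 2t₁`).  Same construction as ★ `exists_adaptedFrame` (★ B7
`frame_mul_frameInv`, `frameInv_mul_frame`, `frame_transpose_mul_gram_mul_frame`, `reindex_antidiag_eq_antidiagonal_over`). [cite: HarrisKudlaSweet1996, §1 (1.11)] -/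
theorem exists_antidiagFrame (hT : T₂ = !![t₁, 0; 0, t₂]) (h₁ : t₁ ≠ 0) (h₂ : t₂ ≠ 0) :
    ∃ (D Dinv : Matrix (Fin 2) (Fin 2) F) (Q : GL (Fin (2 + 2)) F), D * Dinv = 1 ∧ Dinv * D = 1 ∧
      (Q : Matrix (Fin (2 + 2)) (Fin (2 + 2)) F) = Matrix.reindex (e₂ 2) (e₂ 2) (Matrix.fromBlocks 1 D 1 (-D)) ∧
      (Q : Matrix (Fin (2 + 2)) (Fin (2 + 2)) F)ᵀ * gramD F 2 T₂ * (Q : Matrix (Fin (2 + 2)) (Fin (2 + 2)) F) = (StdForm.antidiagonal (2 + 2)).over F ∧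
      D = !![0, 2⁻¹ * t₁⁻¹; 2⁻¹ * t₂⁻¹, 0] ∧ Dinv = !![0, 2 * t₂; 2 * t₁, 0] := by
  have hT₂d : IsUnit T₂.det := hT ▸ isUnit_det_diagTwo F h₁ h₂
  have hT₂s : T₂.IsSymm := hT ▸ isSymm_diagTwo F
  obtain ⟨D, hD⟩ : ∃ D : Matrix (Fin 2) (Fin 2) F, D = (2 : F)⁻¹ • (T₂⁻¹ * (1 : Matrix (Fin 2) (Fin 2) F).submatrix id Fin.rev) := ⟨_, rfl⟩
  obtain ⟨Qm, hQm'⟩ : ∃ Qm : Matrix (Fin (2 + 2)) (Fin (2 + 2)) F, Qm = Matrix.reindex (e₂ 2) (e₂ 2) (Matrix.fromBlocks 1 D 1 (-D)) := ⟨_, rfl⟩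
  obtain ⟨Qi, hQi⟩ : ∃ Qi : Matrix (Fin (2 + 2)) (Fin (2 + 2)) F, Qi = Matrix.reindex (e₂ 2) (e₂ 2)
      (Matrix.fromBlocks ((2 : F)⁻¹ • (1 : Matrix (Fin 2) (Fin 2) F)) ((2 : F)⁻¹ • 1)
        ((1 : Matrix (Fin 2) (Fin 2) F).submatrix Fin.rev id * T₂) (-((1 : Matrix (Fin 2) (Fin 2) F).submatrix Fin.rev id * T₂))) := ⟨_, rfl⟩
  have hmul : Qm * Qi = 1 := by
    rw [hQm', hQi, reindex_mul_reindex, hD, K2LiuLocalSiegelIwasawaFrame.frame_mul_frameInv hT₂d, Matrix.reindex_apply, Matrix.submatrix_one_equiv]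
  have hmul' : Qi * Qm = 1 := by
    rw [hQm', hQi, reindex_mul_reindex, hD, K2LiuLocalSiegelIwasawaFrame.frameInv_mul_frame hT₂d, Matrix.reindex_apply, Matrix.submatrix_one_equiv]
  have hQ' : Qmᵀ * gramD F 2 T₂ * Qm = (StdForm.antidiagonal (2 + 2)).over F := by
    rw [hQm', gramD, Matrix.transpose_reindex, reindex_mul_reindex, reindex_mul_reindex, hD,
      K2LiuLocalSiegelIwasawaFrame.frame_transpose_mul_gram_mul_frame hT₂s hT₂d, K2LiuLocalSiegelIwasawaFrame.reindex_antidiag_eq_antidiagonal_over]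
  have hDG : D * ((2 : F) • ((1 : Matrix (Fin 2) (Fin 2) F).submatrix Fin.rev id * T₂)) = 1 := by
    rw [hD, Matrix.smul_mul, Matrix.mul_smul, smul_smul, inv_mul_cancel₀ (two_ne_zero : (2 : F) ≠ 0), one_smul, Matrix.mul_assoc,
      ← Matrix.mul_assoc ((1 : Matrix (Fin 2) (Fin 2) F).submatrix id Fin.rev), K2LiuLocalSiegelIwasawaFrame.antidiag_mul_antidiag, Matrix.one_mul,
      Matrix.nonsing_inv_mul T₂ hT₂d]
  have hGD : ((2 : F) • ((1 : Matrix (Fin 2) (Fin 2) F).submatrix Fin.rev id * T₂)) * D = 1 := by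
    rw [hD, Matrix.smul_mul, Matrix.mul_smul, smul_smul, mul_inv_cancel₀ (two_ne_zero : (2 : F) ≠ 0), one_smul, Matrix.mul_assoc,
      ← Matrix.mul_assoc T₂, Matrix.mul_nonsing_inv T₂ hT₂d, Matrix.one_mul, K2LiuLocalSiegelIwasawaFrame.antidiag_mul_antidiag']
  refine ⟨D, (2 : F) • ((1 : Matrix (Fin 2) (Fin 2) F).submatrix Fin.rev id * T₂), ⟨Qm, Qi, hmul, hmul'⟩, hDG, hGD, hQm', hQ', ?_, ?_⟩
  · rw [hD, hT, frameD_of_diagonal F h₁ h₂]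
  · rw [hT, frameDinv_of_diagonal F]

/-- at the frame of record for diagonal `T₂`, ★ [A1-mat] §3's relation reads `d₂ e₁ = ½t₂⁻¹ · 2t₂ = 1` (and `d₁ e₂ = 1`). [folklore] -/
theorem frameOfRecord_d_mul_e (h₁ : t₁ ≠ 0) (h₂ : t₂ ≠ 0) : (2⁻¹ * t₂⁻¹) * (2 * t₂) = (1 : F) ∧ (2⁻¹ * t₁⁻¹) * (2 * t₁) = (1 : F) := by
  constructor
  · rw [mul_mul_mul_comm, inv_mul_cancel₀ (two_ne_zero : (2 : F) ≠ 0), inv_mul_cancel₀ h₂, one_mul]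
  · rw [mul_mul_mul_comm, inv_mul_cancel₀ (two_ne_zero : (2 : F) ≠ 0), inv_mul_cancel₀ h₁, one_mul]

end FrameOfRecord

end Summit.HodgeConjecture.HodgeConjecture.Cruxes.HLiu418.K2LiuLocalFourCornerFrameOfRecord

end
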